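import Literature.NumberTheory.GaloisRepresentations.SemiLocalUnitGroupShapiro
import Literature.NumberTheory.GaloisRepresentations.UnramifiedLocalNorms
import Literature.Algebra.Homology.CohomologicalTrivialityTate
import Literature.Algebra.Homology.CoinducedTateZeroShapiro
import HarnessLib

/-!
# `Ĥ⁰(Gal(E/F), ∏_{w ∣ v} 𝒪_wˣ) = 0`, `Ĥ⁰(G_w, 𝒪_wˣ) = 0`, `Ĥ⁰(Gal(E_w/F_v), 𝒪_wˣ) = 0` at an unramified place:
# the units of `F_v` are norms of units of `E_w` (Harari §13.1 / Prop. 8.3; Serre V §2 Cor.; Tate VII §7.3)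

Topic `NumberTheory/GaloisRepresentations`; namespaces `Literature.NumberTheory.GaloisRepresentations.Herbrand`
(§0, generic) and `….SemiLocal`, continuing `SemiLocalUnitGroupShapiro.lean` (the `G`-module
`unitGroupRep F E v = ∏_{w∣v} 𝒪_wˣ` built by `Herbrand.stableRepr`, its `G_w`-form `localIntUnitsRep w`,
its `Gal(E_w/F_v)`-form `placeUnitGroupRep w`, `unitGroupRepIsoCoind : ∏ 𝒪_wˣ ≅ Coind_{G_w}^G 𝒪_wˣ`,
`decompMulEquiv : G_w ≃* Gal(E_w/F_v)`) and `UnramifiedLocalNorms.lean` (Childress Lemma 5.3 (a) in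
semi-local element form: `exists_unitGroup_norm_eq_of_isUnramifiedIn` — at a place `v` unramified in
`E`, every `Gal(E/F)`-fixed element of `∏_{w∣v} 𝒪_wˣ` is a `Gal(E/F)`-norm from it).  Theorems only; NO
definition, no named fact, no `sorry`, no instance; number fields in `Type`.

This file turns that element-form theorem into the vanishing of the degree-`0` Tate cohomology of the
three packagings (Mathlib `tateCohomology`; the engine's carrier `A^G ⧸ N_G A`,
`CohomologicalTriviality.isZero_tateCohomology_zero_iff`): for the `G`-module `∏_{w∣v} 𝒪_wˣ` directly
(§1); for the `G_w`-module `𝒪_wˣ` by transport along `∏ 𝒪_wˣ ≅ Coind 𝒪_wˣ`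
(`(tateCohomologyFunctor 0).mapIso`) and the engine's degree-`0` Shapiro computation
`CoindShapiro.map_invariantsCoindEquiv_range_normBar` (§2); for the `Gal(E_w/F_v)`-module by reindexing
along `decompMulEquiv` (§3).  In words: **at an unramified place every unit of `F_v = E_w^{G_w}` is the
norm of a unit of `E_w`** (Serre, *Local Fields* V §2 Cor. to Prop. 3; Harari Prop. 8.3, degree `0`), in
the completion dialect of a global Galois extension.  Together with `H¹ = 0`
(`SemiLocalUnitGroupUnramifiedH1.lean`) this is the pair of consecutive Tate degrees of the FULL group;
the same pair for every SUBGROUP (base change `E/E^K`, not here) is what the engine's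
`isCohomologicallyTrivial_of_isZero_tateCohomology` consumes.

## What is formalised

* §0 (`Herbrand`, generic: `G` finite acting on a commutative group `M`, `A ≤ M` stable):
  `coe_toMul_norm_stableRepr` (the representation norm of `stableRepr` is the Herbrand norm
  `∏_g g • a` of `CyclicHerbrandQuotient.lean`), `range_normBar_stableRepr_eq_top` (element form
  "fixed ⇒ norm" ⟹ `range normBar = ⊤`).
* §1 `range_normBar_unitGroupRepr_eq_top`, **`isZero_tateCohomology_zero_unitGroupRep`**:
  `Ĥ⁰(Gal(E/F), ∏_{w∣v} 𝒪_wˣ) = 0` for `v` unramified in `E` (`Algebra.IsUnramifiedIn (𝓞 E) v`).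
* §2 `range_normBar_localIntUnitsRep_eq_top`, **`isZero_tateCohomology_zero_localIntUnitsRep`**:
  `Ĥ⁰(G_w, 𝒪_wˣ) = 0`; element form `exists_norm_eq_of_fixed_localIntUnits`.
* §3 `range_normBar_placeUnitGroupRep_eq_top`, **`isZero_tateCohomology_zero_placeUnitGroupRep`**:
  `Ĥ⁰(Gal(E_w/F_v), 𝒪_wˣ) = 0` (for any `Fintype` structure on the finite group `Gal(E_w/F_v)`).

## References
* D. Harari, *Galois Cohomology and Class Field Theory*, Springer (2020), Prop. 8.3, §13.1 (proof of
  Prop. 13.1 (b): "`Ĥ^i(G, U_K(v)) = Ĥ^i(G_v, U_{K,v}) = 0`"). [Harari2020]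
* J.-P. Serre, *Local Fields*, GTM 67 (1979), Ch. V §2 Prop. 3 and Cor. (units are norms in unramified
  extensions), Ch. XII §3. [SerreLocalFields1979]
* N. Childress, *Class Field Theory* (2009), Ch. 4 §5 Lemma 5.3 (a), Prop. 5.7 (iii). [Childress2009]
* J. W. S. Cassels, A. Fröhlich (eds.), *Algebraic Number Theory* (1967), Ch. VII (Tate) §7.3.
  [CasselsFrohlichANT1967]
-/

noncomputable section

open NumberField IsDedekindDomain CategoryTheory CategoryTheory.Limits groupCohomology
open Literature.NumberTheory.Automorphic
open scoped Classical

namespace Literature.NumberTheory.GaloisRepresentations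

/-! ## §0. The norm of `stableRepr` is the Herbrand norm -/

namespace Herbrand

open Literature.Algebra.Homology

variable {G M : Type} [Group G] [Fintype G] [CommGroup M] [MulDistribMulAction G M] (A : Subgroup M)
  (hA : ∀ (g : G) (a : M), a ∈ A → MulDistribMulAction.toMulAut G M g a ∈ A)

/-- The representation norm `Σ_g g·x` of `stableRepr` read in `M` is the Herbrand norm `∏_g g • a`.
[cite: Childress2009, Ch. 4 §4 (PDF p. 84) (the norm `s(G)`)] -/
theorem coe_toMul_norm_stableRepr (x : Additive A) :
    ((Additive.toMul ((stableRepr (MulDistribMulAction.toMulAut G M) A hA).norm x) : A) : M) =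
      Herbrand.norm G ((Additive.toMul x : A) : M) := by
  rw [Representation.norm, LinearMap.sum_apply, toMul_sum, Subgroup.val_finsetProd, Herbrand.norm_apply]
  rfl

/-- **Element form ⟹ `Ĥ⁰ = 0`**: if every `G`-fixed element of `A` is the Herbrand norm of an element
of `A`, then `range normBar = ⊤` for `stableRepr` (`A^G = N_G A`).
[cite: Childress2009, Ch. 4 §4 (PDF p. 84)] -/
theorem range_normBar_stableRepr_eq_top
    (h : ∀ z ∈ A, (∀ g : G, g • z = z) → ∃ y ∈ A, Herbrand.norm G y = z) :
    LinearMap.range (normBar (stableRepr (MulDistribMulAction.toMulAut G M) A hA)) = ⊤ := by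
  rw [CohomologicalTriviality.range_normBar_eq_top_iff]
  intro a ha
  have hfix : ∀ g : G, g • ((Additive.toMul a : A) : M) = ((Additive.toMul a : A) : M) := fun g => by
    have := congrArg (fun b : Additive A => ((Additive.toMul b : A) : M)) (ha g)
    simpa only [coe_toMul_stableRepr, MulDistribMulAction.toMulAut_apply,
      MulDistribMulAction.toMulEquiv_apply] using this
  obtain ⟨y, hy, hNy⟩ := h _ (Additive.toMul a).2 hfix
  refine ⟨Additive.ofMul ⟨y, hy⟩, ?_⟩
  apply Additive.toMul.injective
  refine Subtype.ext ?_
  rw [coe_toMul_norm_stableRepr]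
  exact hNy

end Herbrand

namespace SemiLocal

open Literature.Algebra.Homology

variable {F : Type} [Field F] [NumberField F] {E : Type} [Field E] [NumberField E] [Algebra F E]
variable {v : HeightOneSpectrum (𝓞 F)}

/-! ## §1. `Ĥ⁰(Gal(E/F), ∏_{w ∣ v} 𝒪_wˣ) = 0` at an unramified place -/

/-- **`(∏_{w∣v} 𝒪_wˣ)^G = N_G(∏_{w∣v} 𝒪_wˣ)`** at a place `v` unramified in `E` (the tree's
`exists_unitGroup_norm_eq_of_isUnramifiedIn`, Childress Lemma 5.3 (a), in the engine's `normBar` form).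
[cite: Childress2009, Ch. 4 §5 Lemma 5.3 (a), Prop. 5.7 (iii) (PDF pp. 95, 99)] -/
theorem range_normBar_unitGroupRepr_eq_top [IsGalois F E] (hunr : Algebra.IsUnramifiedIn (𝓞 E) v.asIdeal) :
    LinearMap.range (normBar (unitGroupRepr F E v)) = ⊤ :=
  Herbrand.range_normBar_stableRepr_eq_top (unitGroup F E v) _ fun _ hz hfix =>
    exists_unitGroup_norm_eq_of_isUnramifiedIn hunr hz hfix

/-- **`Ĥ⁰(Gal(E/F), ∏_{w∣v} 𝒪_wˣ) = 0`** at a place `v` unramified in `E` (Harari: "`Ĥ^i(G, U_K(v)) = 0`",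
degree `0`). [cite: Harari2020, §13.1 (proof of Prop. 13.1 (b))] -/
theorem isZero_tateCohomology_zero_unitGroupRep [IsGalois F E] (hunr : Algebra.IsUnramifiedIn (𝓞 E) v.asIdeal) :
    IsZero (tateCohomology (unitGroupRep F E v) 0) :=
  CohomologicalTriviality.isZero_tateCohomology_zero_of_range_normBar_eq_top _
    (range_normBar_unitGroupRepr_eq_top hunr)

/-! ## §2. `Ĥ⁰(G_w, 𝒪_wˣ) = 0`: the units of `F_v` are norms of units of `E_w` -/

/-- **`(𝒪_wˣ)^{G_w} = N_{G_w}(𝒪_wˣ)`** at a place unramified in `E`: transported from §1 along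
`∏_{w∣v} 𝒪_wˣ ≅ Coind_{G_w}^G 𝒪_wˣ` (`(tateCohomologyFunctor 0).mapIso unitGroupRepIsoCoind`) and the
degree-`0` Shapiro computation `(Coind B)^G/N_G ≅ B^{G_w}/N_{G_w}`
(`CoindShapiro.map_invariantsCoindEquiv_range_normBar`).
[cite: Harari2020, §13.1 (proof of Prop. 13.1 (b))][cite: SerreLocalFields1979, Ch. V §2 Cor. to Prop. 3] -/
theorem range_normBar_localIntUnitsRep_eq_top [IsGalois F E] (w : Place F E v)
    (hunr : Algebra.IsUnramifiedIn (𝓞 E) v.asIdeal) :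
    LinearMap.range (normBar (localIntUnitsRep w).ρ) = ⊤ := by
  have h1 : IsZero (tateCohomology
      (Rep.coind (MulAction.stabilizer (E ≃ₐ[F] E) w).subtype (localIntUnitsRep w)) 0) :=
    (isZero_tateCohomology_zero_unitGroupRep hunr).of_iso
      ((tateCohomologyFunctor 0).mapIso (unitGroupRepIsoCoind w)).symm
  have h2 := CohomologicalTriviality.range_normBar_eq_top_of_isZero_tateCohomology_zero _ h1
  rw [← CoindShapiro.map_invariantsCoindEquiv_range_normBar, h2, Submodule.map_top, LinearEquiv.range]

/-- **`Ĥ⁰(G_w, 𝒪_wˣ) = 0`** at a place unramified in `E` (Harari: "`= Ĥ^i(G_v, U_{K,v}) = 0`", degree `0`).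
[cite: Harari2020, §13.1 (proof of Prop. 13.1 (b))] -/
theorem isZero_tateCohomology_zero_localIntUnitsRep [IsGalois F E] (w : Place F E v)
    (hunr : Algebra.IsUnramifiedIn (𝓞 E) v.asIdeal) :
    IsZero (tateCohomology (localIntUnitsRep w) 0) :=
  CohomologicalTriviality.isZero_tateCohomology_zero_of_range_normBar_eq_top _
    (range_normBar_localIntUnitsRep_eq_top w hunr)

/-- **Element form: every `G_w`-fixed unit of `𝒪_w` — i.e. every unit of `𝒪_v ⊆ F_v = E_w^{G_w}` — is the
`G_w`-norm of a unit of `𝒪_w`**, at a place unramified in `E` (units are norms in unramified extensions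
of local fields, completion dialect). [cite: SerreLocalFields1979, Ch. V §2 Cor. to Prop. 3] -/
theorem exists_norm_eq_of_fixed_localIntUnits [IsGalois F E] (w : Place F E v)
    (hunr : Algebra.IsUnramifiedIn (𝓞 E) v.asIdeal) (u : placeUnitGroup w)
    (hu : ∀ g : MulAction.stabilizer (E ≃ₐ[F] E) w,
      (localIntUnitsRep w).ρ g (Additive.ofMul u) = Additive.ofMul u) :
    ∃ y : placeUnitGroup w, (localIntUnitsRep w).ρ.norm (Additive.ofMul y) = Additive.ofMul u := by
  obtain ⟨y, hy⟩ := (CohomologicalTriviality.range_normBar_eq_top_iff _).mp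
    (range_normBar_localIntUnitsRep_eq_top w hunr) (Additive.ofMul u) hu
  exact ⟨Additive.toMul y, hy⟩

/-! ## §3. `Ĥ⁰(Gal(E_w/F_v), 𝒪_wˣ) = 0` -/

/-- **`(𝒪_wˣ)^{Gal(E_w/F_v)} = N(𝒪_wˣ)`** at a place unramified in `E`: §2 reindexed along
`decompMulEquiv w : G_w ≃* Gal(E_w/F_v)` (same module, `Fintype.sum_equiv`); for any `Fintype` structure
on `Gal(E_w/F_v)`. [cite: SerreLocalFields1979, Ch. V §2 Cor. to Prop. 3] -/
theorem range_normBar_placeUnitGroupRep_eq_top [IsGalois F E] (w : Place F E v)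
    [Fintype ((w : HeightOneSpectrum (𝓞 E)).adicCompletion E ≃ₐ[v.adicCompletion F]
      (w : HeightOneSpectrum (𝓞 E)).adicCompletion E)]
    (hunr : Algebra.IsUnramifiedIn (𝓞 E) v.asIdeal) :
    LinearMap.range (normBar (placeUnitGroupRep w).ρ) = ⊤ := by
  rw [CohomologicalTriviality.range_normBar_eq_top_iff]
  intro a ha
  have ha' : a ∈ (localIntUnitsRep w).ρ.invariants := fun g => ha (decompMulEquiv w g)
  obtain ⟨y, hy⟩ := (CohomologicalTriviality.range_normBar_eq_top_iff _).mp
    (range_normBar_localIntUnitsRep_eq_top w hunr) a ha'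
  refine ⟨y, ?_⟩
  rw [← hy, Representation.norm, Representation.norm, LinearMap.sum_apply, LinearMap.sum_apply]
  exact (Fintype.sum_equiv (decompMulEquiv w).toEquiv _ _ fun g => rfl).symm

/-- **`Ĥ⁰(Gal(E_w/F_v), 𝒪_wˣ) = 0`** at a place unramified in `E`.
[cite: Harari2020, Prop. 8.3][cite: SerreLocalFields1979, Ch. V §2 Cor. to Prop. 3] -/
theorem isZero_tateCohomology_zero_placeUnitGroupRep [IsGalois F E] (w : Place F E v)
    [Fintype ((w : HeightOneSpectrum (𝓞 E)).adicCompletion E ≃ₐ[v.adicCompletion F]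
      (w : HeightOneSpectrum (𝓞 E)).adicCompletion E)]
    (hunr : Algebra.IsUnramifiedIn (𝓞 E) v.asIdeal) :
    IsZero (tateCohomology (placeUnitGroupRep w) 0) :=
  CohomologicalTriviality.isZero_tateCohomology_zero_of_range_normBar_eq_top _
    (range_normBar_placeUnitGroupRep_eq_top w hunr)

end SemiLocal

end Literature.NumberTheory.GaloisRepresentations

end
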